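import Literature.NumberTheory.ComplexMultiplication.CMOrderCohenMacaulayTypeMaximalOrderPrime
import HarnessLib

/-!
# The over-order `T = S + 𝔭𝒪_K` of an order and MARSEGLIA 2024 PROPOSITION 4.5:
# `dim_{S/𝔭} 𝒪_K/𝔭𝒪_K = 1 + type(S + 𝔭𝒪_K)` at a non-invertible prime `𝔭`

Family `hodge`, lane `lit-hodgefound` (Track 2 foundations library; seat p15, row g28-#7), topic
`Literature/NumberTheory/ComplexMultiplication`, namespace `Literature.NumberTheory.ComplexMultiplication.CMTypeLattice`.
Two orders of the tree's form appear: `S = endOrder (M_μ)` and its over-order `T = endOrder (M_ν)`, tied by the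
hypothesis `hν : ∀ x, x ∈ T ↔ ∃ s ∈ S, ∃ y ∈ 𝔭M, x = s + y` («`T = S + 𝔓`, `𝔓 = 𝔭𝒪_K`»), where `M` is `S`'s copy of
the maximal order (`↑M = range (algebraMap (𝓞 K) K)`, `EndOrder.exists_idempotent_coe_eq_range`) and `𝔭` an ideal of
`S`; the `T`-ideal `𝔓` is tied by `h𝔓 : ∀ t : T, t ∈ 𝔓 ↔ ↑t ∈ 𝔭M`.  §1 proves that such a `ν` EXISTS for every `μ`
and `𝔭`, §2 that such a `𝔓` exists.  The local type `type_𝔔(T) = finrank (T ⧸ 𝔔) (↥↑T′ ⧸ 𝔔 • ⊤)` (`↑T′ = Tᵗ`), the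
global type `type(T) = ⨆ 𝔔, type_𝔔(T)` and `𝒪_K/𝔭𝒪_K = ↥↑M ⧸ 𝔭 • ⊤` are as in `CMOrderCohenMacaulayTypeOne` /
`…Global` / `…MaximalOrderPrime`.  THEOREMS ONLY: no definition, no instance, no named fact (net Literature debt `0`).

## Source, VERBATIM

S. Marseglia, *Cohen-Macaulay type of orders, generators and ideal classes*, J. Algebra 658 (2024) 247–276
[Marseglia2024CMType] (arXiv:2206.03758, held `paper:arxiv-2206.03758`), §4, chunk p0010:

> "Proposition 4.5. Let `𝔭` be a prime of an order `S`. Then `dim_{S/𝔭} 𝒪_K/𝔭𝒪_K = 1` if `𝔭` is invertible,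
> `1 + type_𝔓(S + 𝔭𝒪_K)` otherwise. In particular, if `S` is not maximal then
> `g(S) = 1 + max{type(S + 𝔭𝒪_K) : 𝔭 a prime of S}`.  Proof. Put `𝔓 = 𝔭𝒪_K` and consider the overorder
> `T = S + 𝔓` of `S`. Observe that we have inclusions `𝔭 ⊆ S ∩ 𝔓 ⊆ S`. Since `1` is not in `𝔓`, we have the equality
> `𝔭 = S ∩ 𝔓`. Hence `T/𝔓 = (S + 𝔓)/𝔓 ≃ S/(S ∩ 𝔓) = S/𝔭` (4.1), which, in particular, shows that `𝔓` is a prime of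
> `T`. Note that `(𝔓:𝔓) = 𝒪_K` and so `𝒪_K/𝔭𝒪_K = 𝒪_K/𝔓 = (𝔓:𝔓)/𝔓` (4.2). We already know by Lemma 2.14.(i) that
> `𝔭` is invertible if and only if `𝒪_K/𝔭𝒪_K` has dimension `1` over `S/𝔭`. So we assume that `𝔭` is not
> invertible. If `𝔓` were invertible then by Lemma 2.x we would have `(𝔓:𝔓) = T`. Hence by Equations (4.1) and
> (4.2) we would have that `𝒪_K/𝔭𝒪_K` has dimension `1` as a vector space over `S/𝔭`. Hence `𝔓` is not
> invertible. So we can apply Proposition 3.5 which gives us the first equality in `type_𝔓(T) + 1 =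
> dim_{T/𝔓} (𝔓:𝔓)/𝔓 = dim_{S/𝔭} 𝒪_K/𝔭𝒪_K`, while the last equality is given by Equations (4.1) and (4.2). To
> conclude the proof we need to show that `type_𝔓(T) = type(T)`. […] that is, `type_𝔓(T) = type(T)`."

## What is formalised (the printed proof, step by step)

* §1 (over `S` alone): `𝔭M` plumbing (`mul_coeIdeal_mul_eq_of_coe_eq_range`); «Since `1` is not in `𝔓`»
  (`one_not_mem_coeIdeal_mul`); «`𝔭 = S ∩ 𝔓`» for maximal `𝔭` (`mem_iff_coe_mem_coeIdeal_mul`); **«consider the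
  overorder `T = S + 𝔓`»: `exists_basis_mem_endOrder_iff_exists_add`, the order `S + 𝔭𝒪_K` exists as an
  `endOrder (M_ν)`** (a finitely generated full lattice containing `1` and closed under products).
* §2 (under `hν`): `S ⊆ T` (`endOrder_le_endOrder_of_mem_iff`), `𝔭𝒪_K ⊆ T` (`mem_endOrder_of_mem_coeIdeal_mul`), the
  `T`-ideal `𝔓 = 𝔭𝒪_K` exists (`exists_ideal_mem_iff_coe_mem`); (under `h𝔓`) `↑𝔓 = 𝔭𝒪_K` as sets
  (`coe_coeIdeal_eq_coe_coeIdeal_mul`), `𝒪_K𝔓 = 𝔓` (`mul_coeIdeal_eq_coeIdeal`); **(4.1) `S/𝔭 ≃ T/𝔓`**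
  (`nonempty_quotient_ringEquiv_quotient`, `isMaximal_of_mem_iff`, `natCard_quotient_eq_natCard_quotient`); **(4.2)
  `#(𝒪_K/𝔓𝒪_K) = #(𝒪_K/𝔭𝒪_K)` and `dim_{T/𝔓} 𝒪_K/𝔓 = dim_{S/𝔭} 𝒪_K/𝔭𝒪_K`** (`natCard_quotient_smul_top_eq`,
  `finrank_quotient_smul_top_eq`); «Hence `𝔓` is not invertible», i.e. `T ≠ 𝒪_K`
  (`exists_coe_not_mem_endOrder_of_not_isUnit`, via LEMMA 2.14 (i) `EndOrder.finrank_quotient_eq_one_iff_isUnit_coeIdeal`).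
* §3 **PROPOSITION 4.5: `finrank_quotient_smul_top_eq_finrank_traceDual_quotient_add_one`
  (`dim_{S/𝔭} 𝒪_K/𝔭𝒪_K = type_𝔓(T) + 1`) and `finrank_quotient_smul_top_eq_iSup_finrank_traceDual_quotient_add_one`
  (`= type(T) + 1`)** for a maximal non-invertible `𝔭` (the `T`-side inputs — `𝔓 = (T:𝒪_K)` the unique
  non-invertible prime, `(𝔓:𝔓) = 𝒪_K`, PROP. 3.5, `type(T) = type_𝔓(T)` — are `CMOrderCohenMacaulayTypeMaximalOrderPrime`);
  §4 the basis-free package `exists_basis_finrank_quotient_smul_top_eq_iSup_add_one`.  The invertible case of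
  PROP. 4.5 is LEMMA 2.14 (i), `EndOrder.finrank_quotient_eq_one_iff_isUnit_coeIdeal` (`CMOrderCohenMacaulayTypeOne`);
  the «In particular» clause on `g(S)` needs COR. 4.4 / LEMMA 4.3 [Greither82] and is NOT formalised.
-/

noncomputable section

open scoped nonZeroDivisors NumberField
open NumberField Module FractionalIdeal
open Submodule (traceDual)

namespace Literature.NumberTheory.ComplexMultiplication

namespace CMTypeLattice

variable {K : Type} [Field K] [NumberField K]
variable {ι : Type} [Fintype ι] [DecidableEq ι] (μ : Basis ι ℚ K) [Nonempty ι]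
variable [IsFractionRing (endOrder (Algebra.leftMulMatrix μ)) K]

/-! ## §1 The over-order `T = S + 𝔭𝒪_K` exists in the tree's vocabulary -/

omit [Nonempty ι] [IsFractionRing (endOrder (Algebra.leftMulMatrix μ)) K] in
/-- Plumbing for `𝔓 = 𝔭𝒪_K`: with the maximal order `M = MM ∋ 1` one has `M·(𝔭M) = 𝔭M` and `(𝔭M)(𝔭M) ⊆ 𝔭M`.
[cite: Marseglia2024CMType, §4 Prop. 4.5 (proof: «Put `𝔓 = 𝔭𝒪_K`»), p. 10] -/
theorem mul_coeIdeal_mul_eq_of_coe_eq_range {M : FractionalIdeal (endOrder (Algebra.leftMulMatrix μ))⁰ K}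
    (hMO : (M : Set K) = (algebraMap (𝓞 K) K).range) (𝔭 : Ideal (endOrder (Algebra.leftMulMatrix μ))) :
    M * ((𝔭 : FractionalIdeal (endOrder (Algebra.leftMulMatrix μ))⁰ K) * M) =
      (𝔭 : FractionalIdeal (endOrder (Algebra.leftMulMatrix μ))⁰ K) * M ∧
    (𝔭 : FractionalIdeal (endOrder (Algebra.leftMulMatrix μ))⁰ K) * M *
        ((𝔭 : FractionalIdeal (endOrder (Algebra.leftMulMatrix μ))⁰ K) * M) ≤
      (𝔭 : FractionalIdeal (endOrder (Algebra.leftMulMatrix μ))⁰ K) * M := by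
  obtain ⟨hMMle, h1⟩ := EndOrder.mul_self_le_and_one_mem_of_coe_eq_range hMO
  have hMM := EndOrder.mul_self_eq_of_one_mem_of_mul_self_le h1 hMMle
  have hMP : M * ((𝔭 : FractionalIdeal (endOrder (Algebra.leftMulMatrix μ))⁰ K) * M) =
      (𝔭 : FractionalIdeal (endOrder (Algebra.leftMulMatrix μ))⁰ K) * M := by
    rw [mul_left_comm, hMM]
  refine ⟨hMP, ?_⟩
  calc (𝔭 : FractionalIdeal (endOrder (Algebra.leftMulMatrix μ))⁰ K) * M *
        ((𝔭 : FractionalIdeal (endOrder (Algebra.leftMulMatrix μ))⁰ K) * M)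
        = (𝔭 : FractionalIdeal (endOrder (Algebra.leftMulMatrix μ))⁰ K) *
            (M * ((𝔭 : FractionalIdeal (endOrder (Algebra.leftMulMatrix μ))⁰ K) * M)) := mul_assoc _ _ _
    _ = (𝔭 : FractionalIdeal (endOrder (Algebra.leftMulMatrix μ))⁰ K) *
            ((𝔭 : FractionalIdeal (endOrder (Algebra.leftMulMatrix μ))⁰ K) * M) := by rw [hMP]
    _ ≤ 1 * ((𝔭 : FractionalIdeal (endOrder (Algebra.leftMulMatrix μ))⁰ K) * M) :=
          mul_left_mono coeIdeal_le_one
    _ = (𝔭 : FractionalIdeal (endOrder (Algebra.leftMulMatrix μ))⁰ K) * M := one_mul _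

/-- **«Since `1` is not in `𝔓`»: `1 ∉ 𝔭𝒪_K` for a proper ideal `𝔭` of `S`** (otherwise `𝔭𝒪_K = 𝒪_K`, whereas
`dim_{S/𝔪} 𝒪_K/𝔪𝒪_K ≥ 1` at a maximal `𝔪 ⊇ 𝔭`). [cite: Marseglia2024CMType, §4 Prop. 4.5 (proof), p. 10] -/
theorem one_not_mem_coeIdeal_mul {M : FractionalIdeal (endOrder (Algebra.leftMulMatrix μ))⁰ K}
    (hMO : (M : Set K) = (algebraMap (𝓞 K) K).range) {𝔭 : Ideal (endOrder (Algebra.leftMulMatrix μ))} (h𝔭 : 𝔭 ≠ ⊤) :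
    (1 : K) ∉ (𝔭 : FractionalIdeal (endOrder (Algebra.leftMulMatrix μ))⁰ K) * M := by
  intro h1
  obtain ⟨𝔪, h𝔪, hle⟩ := Ideal.exists_le_maximal 𝔭 h𝔭
  obtain ⟨hMMle, h1M⟩ := EndOrder.mul_self_le_and_one_mem_of_coe_eq_range hMO
  have hM0 : M ≠ 0 := fun h ↦ by rw [h] at h1M; exact one_ne_zero ((mem_zero_iff _).1 h1M)
  obtain ⟨hMP, -⟩ := mul_coeIdeal_mul_eq_of_coe_eq_range μ hMO 𝔪
  -- `1 ∈ 𝔭M ⊆ 𝔪M`, so `𝔪M = M`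
  have h1' : (1 : K) ∈ (𝔪 : FractionalIdeal (endOrder (Algebra.leftMulMatrix μ))⁰ K) * M :=
    mul_left_mono ((coeIdeal_le_coeIdeal K).2 hle) h1
  have hPM : (𝔪 : FractionalIdeal (endOrder (Algebra.leftMulMatrix μ))⁰ K) * M = M := by
    refine le_antisymm ((mul_left_mono coeIdeal_le_one).trans_eq (one_mul M)) fun m hm ↦ ?_
    rw [← hMP, ← mul_one m]
    exact mul_mem_mul hm h1'
  -- hence `#(M/𝔪M) = 1`, contradicting `dim_{S/𝔪} M/𝔪M ≥ 1` and `#(S/𝔪) ≥ 2`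
  have h0 : 𝔪 ≠ ⊥ := Ring.ne_bot_of_isMaximal_of_not_isField h𝔪 EndOrder.not_isField
  haveI := isNoetherianRing_endOrder (Algebra.leftMulMatrix μ)
  have hfg : ((M : FractionalIdeal (endOrder (Algebra.leftMulMatrix μ))⁰ K) :
      Submodule (endOrder (Algebra.leftMulMatrix μ)) K).FG := fg_of_isNoetherianRing le_rfl M
  have hpos := NumberRing.finrank_quotient_smul_top_pos (K := K) 𝔪 hfg
    (fun h ↦ hM0 (coeToSubmodule_eq_bot.1 h))
  letI : Field (endOrder (Algebra.leftMulMatrix μ) ⧸ 𝔪) := Ideal.Quotient.field 𝔪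
  haveI := NumberRing.finite_quotient_smul_top (K := K) 𝔪 hfg
  have hc1 : Nat.card (↥((M : FractionalIdeal (endOrder (Algebra.leftMulMatrix μ))⁰ K) :
      Submodule (endOrder (Algebra.leftMulMatrix μ)) K) ⧸
      (𝔪 • ⊤ : Submodule (endOrder (Algebra.leftMulMatrix μ))
        ↥((M : FractionalIdeal (endOrder (Algebra.leftMulMatrix μ))⁰ K) :
          Submodule (endOrder (Algebra.leftMulMatrix μ)) K))) = 1 := by
    rw [← natCard_quotient_comap_coeIdeal_mul μ 𝔪 M, natCard_quotient_comap_congr rfl (congr_arg _ hPM),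
      Submodule.comap_subtype_self]
    exact Nat.card_unique
  rw [Module.natCard_eq_pow_finrank (K := endOrder (Algebra.leftMulMatrix μ) ⧸ 𝔪)] at hc1
  have h2 := one_lt_natCard_quotient μ h0 h𝔪.ne_top
  have hq : Nat.card (endOrder (Algebra.leftMulMatrix μ) ⧸ 𝔪) ^ 1 ≤
      Nat.card (endOrder (Algebra.leftMulMatrix μ) ⧸ 𝔪) ^ Module.finrank (endOrder (Algebra.leftMulMatrix μ) ⧸ 𝔪)
        (↥((M : FractionalIdeal (endOrder (Algebra.leftMulMatrix μ))⁰ K) :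
            Submodule (endOrder (Algebra.leftMulMatrix μ)) K) ⧸
          (𝔪 • ⊤ : Submodule (endOrder (Algebra.leftMulMatrix μ))
            ↥((M : FractionalIdeal (endOrder (Algebra.leftMulMatrix μ))⁰ K) :
              Submodule (endOrder (Algebra.leftMulMatrix μ)) K))) :=
    Nat.pow_le_pow_right (by omega) hpos
  rw [pow_one, hc1] at hq
  omega

/-- **«Observe that we have inclusions `𝔭 ⊆ S ∩ 𝔓 ⊆ S`. Since `1` is not in `𝔓`, we have the equality `𝔭 = S ∩ 𝔓`»**:
for a maximal ideal `𝔭` of `S` and `s ∈ S`, `s ∈ 𝔭 ⟺ s ∈ 𝔭𝒪_K`. [cite: Marseglia2024CMType, §4 Prop. 4.5 (proof),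
p. 10] -/
theorem mem_iff_coe_mem_coeIdeal_mul {M : FractionalIdeal (endOrder (Algebra.leftMulMatrix μ))⁰ K}
    (hMO : (M : Set K) = (algebraMap (𝓞 K) K).range) {𝔭 : Ideal (endOrder (Algebra.leftMulMatrix μ))}
    [h𝔭 : 𝔭.IsMaximal] (s : endOrder (Algebra.leftMulMatrix μ)) :
    s ∈ 𝔭 ↔ (s : K) ∈ (𝔭 : FractionalIdeal (endOrder (Algebra.leftMulMatrix μ))⁰ K) * M := by
  obtain ⟨-, h1M⟩ := EndOrder.mul_self_le_and_one_mem_of_coe_eq_range hMO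
  -- `J = S ∩ 𝔭M` is an ideal of `S` with `𝔭 ⊆ J ≠ S`
  set J : Ideal (endOrder (Algebra.leftMulMatrix μ)) :=
    ((((𝔭 : FractionalIdeal (endOrder (Algebra.leftMulMatrix μ))⁰ K) * M :
      FractionalIdeal (endOrder (Algebra.leftMulMatrix μ))⁰ K) : Submodule (endOrder (Algebra.leftMulMatrix μ)) K).comap
      (Algebra.linearMap (endOrder (Algebra.leftMulMatrix μ)) K)) with hJ
  have hmemJ : ∀ r : endOrder (Algebra.leftMulMatrix μ),
      r ∈ J ↔ (r : K) ∈ (𝔭 : FractionalIdeal (endOrder (Algebra.leftMulMatrix μ))⁰ K) * M := fun r ↦ Iff.rfl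
  have hle : 𝔭 ≤ J := fun r hr ↦ (hmemJ r).2 (by
    rw [← mul_one (r : K)]
    exact mul_mem_mul ((mem_coeIdeal _).2 ⟨r, hr, rfl⟩) h1M)
  have hJtop : J ≠ ⊤ := fun h ↦ one_not_mem_coeIdeal_mul μ hMO h𝔭.ne_top (by
    have h1 : (1 : endOrder (Algebra.leftMulMatrix μ)) ∈ J := h ▸ Submodule.mem_top
    rw [hmemJ, OneMemClass.coe_one] at h1
    exact h1)
  rw [← hmemJ, h𝔭.eq_of_le hJtop hle]

omit [Nonempty ι] [IsFractionRing (endOrder (Algebra.leftMulMatrix μ)) K] in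
/-- **«Consider the overorder `T = S + 𝔓` of `S`», `𝔓 = 𝔭𝒪_K`: the order `S + 𝔭𝒪_K` exists as an `endOrder (M_ν)`.**
For the order `S = endOrder (M_μ)`, the maximal order `M` (`↑M = 𝒪_K`) and an ideal `𝔭` of `S`, there is a
`ℚ`-basis `ν` of `K` whose order is exactly `{s + y : s ∈ S, y ∈ 𝔭𝒪_K}` (`S + 𝔭M` is a finitely generated
full lattice containing `1` and closed under products, hence `⊕ ℤνⱼ` and its own order).
[cite: Marseglia2024CMType, §4 Prop. 4.5 (proof), p. 10] -/
theorem exists_basis_mem_endOrder_iff_exists_add {M : FractionalIdeal (endOrder (Algebra.leftMulMatrix μ))⁰ K}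
    (hMO : (M : Set K) = (algebraMap (𝓞 K) K).range) (𝔭 : Ideal (endOrder (Algebra.leftMulMatrix μ))) :
    ∃ ν : Basis ι ℚ K, ∀ x : K, x ∈ endOrder (Algebra.leftMulMatrix ν) ↔
      ∃ s ∈ endOrder (Algebra.leftMulMatrix μ),
        ∃ y ∈ (𝔭 : FractionalIdeal (endOrder (Algebra.leftMulMatrix μ))⁰ K) * M, x = s + y := by
  set P : FractionalIdeal (endOrder (Algebra.leftMulMatrix μ))⁰ K :=
    (𝔭 : FractionalIdeal (endOrder (Algebra.leftMulMatrix μ))⁰ K) * M with hP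
  obtain ⟨-, hPP⟩ := mul_coeIdeal_mul_eq_of_coe_eq_range μ hMO 𝔭
  set N : Submodule ℤ K :=
    ((1 : FractionalIdeal (endOrder (Algebra.leftMulMatrix μ))⁰ K) :
        Submodule (endOrder (Algebra.leftMulMatrix μ)) K).restrictScalars ℤ ⊔
      (P : Submodule (endOrder (Algebra.leftMulMatrix μ)) K).restrictScalars ℤ with hN
  have hmem : ∀ x : K, x ∈ N ↔ ∃ s ∈ endOrder (Algebra.leftMulMatrix μ), ∃ y ∈ P, x = s + y := by
    intro x
    rw [Submodule.mem_sup]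
    constructor
    · rintro ⟨a, ha, b, hb, rfl⟩
      rw [Submodule.restrictScalars_mem, mem_coe, mem_one_iff] at ha
      obtain ⟨s, rfl⟩ := ha
      exact ⟨s, s.2, b, hb, rfl⟩
    · rintro ⟨s, hs, y, hy, rfl⟩
      exact ⟨s, by rw [Submodule.restrictScalars_mem, mem_coe, mem_one_iff]; exact ⟨⟨s, hs⟩, rfl⟩, y, hy, rfl⟩
  have hfg : N.FG := (fg_restrictScalars_coe μ 1).sup (fg_restrictScalars_coe μ P)
  have hsp : (⊤ : Submodule ℚ K) ≤ Submodule.span ℚ (N : Set K) :=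
    (top_le_span_restrictScalars_coe μ (one_ne_zero' (FractionalIdeal (endOrder (Algebra.leftMulMatrix μ))⁰ K))).trans
      (Submodule.span_mono fun x hx ↦ Submodule.mem_sup_left hx)
  obtain ⟨ν, hν⟩ := exists_basis_span_eq_of_fg μ N hfg hsp
  refine ⟨ν, fun x ↦ ?_⟩
  rw [← hmem, ← hν]
  refine mem_endOrder_iff_of_one_mem_of_mul_mem ν ?_ ?_ x
  · rw [hν, hmem]
    exact ⟨1, Subring.one_mem _, 0, zero_mem P, by rw [add_zero]⟩
  · intro a ha b hb
    rw [hν, hmem] at ha hb ⊢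
    obtain ⟨s, hs, y, hy, rfl⟩ := ha
    obtain ⟨s', hs', y', hy', rfl⟩ := hb
    refine ⟨s * s', Subring.mul_mem _ hs hs', s * y' + y * s' + y * y', ?_, by ring⟩
    refine Submodule.add_mem (P : Submodule (endOrder (Algebra.leftMulMatrix μ)) K)
      (Submodule.add_mem (P : Submodule (endOrder (Algebra.leftMulMatrix μ)) K) ?_ ?_) (hPP (mul_mem_mul hy hy'))
    · exact Submodule.smul_mem (P : Submodule (endOrder (Algebra.leftMulMatrix μ)) K) ⟨s, hs⟩ hy'
    · rw [mul_comm]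
      exact Submodule.smul_mem (P : Submodule (endOrder (Algebra.leftMulMatrix μ)) K) ⟨s', hs'⟩ hy

/-! ## §2 The over-order `T = S + 𝔭𝒪_K` and its ideal `𝔓 = 𝔭𝒪_K` -/

section PlusPrime

variable (ν : Basis ι ℚ K) [IsFractionRing (endOrder (Algebra.leftMulMatrix ν)) K]
  {M : FractionalIdeal (endOrder (Algebra.leftMulMatrix μ))⁰ K}
  (hMO : (M : Set K) = (algebraMap (𝓞 K) K).range) {𝔭 : Ideal (endOrder (Algebra.leftMulMatrix μ))}
  (hν : ∀ x : K, x ∈ endOrder (Algebra.leftMulMatrix ν) ↔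
    ∃ s ∈ endOrder (Algebra.leftMulMatrix μ),
      ∃ y ∈ (𝔭 : FractionalIdeal (endOrder (Algebra.leftMulMatrix μ))⁰ K) * M, x = s + y)

include hν

omit [Nonempty ι] [IsFractionRing (endOrder (Algebra.leftMulMatrix μ)) K]
  [IsFractionRing (endOrder (Algebra.leftMulMatrix ν)) K] in
/-- **`S ⊆ T = S + 𝔭𝒪_K`: `T` is an over-order of `S`.** [cite: Marseglia2024CMType, §4 Prop. 4.5 (proof: «the
overorder `T = S + 𝔓` of `S`»), p. 10] -/
theorem endOrder_le_endOrder_of_mem_iff : endOrder (Algebra.leftMulMatrix μ) ≤ endOrder (Algebra.leftMulMatrix ν) :=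
  fun s hs ↦ (hν s).2 ⟨s, hs, 0, zero_mem _, by rw [add_zero]⟩

omit [Nonempty ι] [IsFractionRing (endOrder (Algebra.leftMulMatrix μ)) K]
  [IsFractionRing (endOrder (Algebra.leftMulMatrix ν)) K] in
/-- **`𝔭𝒪_K ⊆ T`.** [cite: Marseglia2024CMType, §4 Prop. 4.5 (proof), p. 10] -/
theorem mem_endOrder_of_mem_coeIdeal_mul {y : K}
    (hy : y ∈ (𝔭 : FractionalIdeal (endOrder (Algebra.leftMulMatrix μ))⁰ K) * M) :
    y ∈ endOrder (Algebra.leftMulMatrix ν) :=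
  (hν y).2 ⟨0, Subring.zero_mem _, y, hy, by rw [zero_add]⟩

include hMO in
omit [Nonempty ι] [IsFractionRing (endOrder (Algebra.leftMulMatrix μ)) K]
  [IsFractionRing (endOrder (Algebra.leftMulMatrix ν)) K] in
/-- **`𝔓 = 𝔭𝒪_K` is an ideal of `T`** («which, in particular, shows that `𝔓` is a prime of `T`» comes in §3): the
subset `𝔭𝒪_K ⊆ T` is closed under multiplication by `T = S + 𝔭𝒪_K`. [cite: Marseglia2024CMType, §4 Prop. 4.5
(proof), p. 10] -/
theorem exists_ideal_mem_iff_coe_mem :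
    ∃ 𝔓 : Ideal (endOrder (Algebra.leftMulMatrix ν)), ∀ t : endOrder (Algebra.leftMulMatrix ν),
      t ∈ 𝔓 ↔ (t : K) ∈ (𝔭 : FractionalIdeal (endOrder (Algebra.leftMulMatrix μ))⁰ K) * M := by
  obtain ⟨-, hPP⟩ := mul_coeIdeal_mul_eq_of_coe_eq_range μ hMO 𝔭
  refine ⟨{ carrier := {t | (t : K) ∈ (𝔭 : FractionalIdeal (endOrder (Algebra.leftMulMatrix μ))⁰ K) * M}
            add_mem' := fun {a b} ha hb ↦ ?_
            zero_mem' := ?_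
            smul_mem' := fun t {a} ha ↦ ?_ }, fun t ↦ Iff.rfl⟩
  · simp only [Set.mem_setOf_eq, Subring.coe_add]
    exact Submodule.add_mem
      (((𝔭 : FractionalIdeal (endOrder (Algebra.leftMulMatrix μ))⁰ K) * M :
        FractionalIdeal (endOrder (Algebra.leftMulMatrix μ))⁰ K) : Submodule (endOrder (Algebra.leftMulMatrix μ)) K) ha hb
  · simp only [Set.mem_setOf_eq, Subring.coe_zero]
    exact zero_mem _
  · simp only [Set.mem_setOf_eq, smul_eq_mul, Subring.coe_mul] at ha ⊢
    obtain ⟨s, hs, y, hy, ht⟩ := (hν t).1 t.2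
    rw [ht, add_mul]
    refine Submodule.add_mem
      (((𝔭 : FractionalIdeal (endOrder (Algebra.leftMulMatrix μ))⁰ K) * M :
        FractionalIdeal (endOrder (Algebra.leftMulMatrix μ))⁰ K) : Submodule (endOrder (Algebra.leftMulMatrix μ)) K)
      ?_ (hPP (mul_mem_mul hy ha))
    exact Submodule.smul_mem
      (((𝔭 : FractionalIdeal (endOrder (Algebra.leftMulMatrix μ))⁰ K) * M :
        FractionalIdeal (endOrder (Algebra.leftMulMatrix μ))⁰ K) : Submodule (endOrder (Algebra.leftMulMatrix μ)) K)
      ⟨s, hs⟩ ha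

variable {𝔓 : Ideal (endOrder (Algebra.leftMulMatrix ν))}
  (h𝔓 : ∀ t : endOrder (Algebra.leftMulMatrix ν),
    t ∈ 𝔓 ↔ (t : K) ∈ (𝔭 : FractionalIdeal (endOrder (Algebra.leftMulMatrix μ))⁰ K) * M)

include h𝔓

omit [Nonempty ι] [IsFractionRing (endOrder (Algebra.leftMulMatrix μ)) K]
  [IsFractionRing (endOrder (Algebra.leftMulMatrix ν)) K] in
/-- **`𝔓 = 𝔭𝒪_K` as subsets of `K`**: the `T`-ideal `𝔓` and the `S`-lattice `𝔭𝒪_K` coincide.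
[cite: Marseglia2024CMType, §4 Prop. 4.5 (proof: «Put `𝔓 = 𝔭𝒪_K`»), p. 10] -/
theorem coe_coeIdeal_eq_coe_coeIdeal_mul :
    ((𝔓 : FractionalIdeal (endOrder (Algebra.leftMulMatrix ν))⁰ K) : Set K) =
      (((𝔭 : FractionalIdeal (endOrder (Algebra.leftMulMatrix μ))⁰ K) * M :
        FractionalIdeal (endOrder (Algebra.leftMulMatrix μ))⁰ K) : Set K) := by
  ext x
  rw [SetLike.mem_coe, SetLike.mem_coe, mem_coeIdeal]
  constructor
  · rintro ⟨t, ht, rfl⟩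
    exact (h𝔓 t).1 ht
  · intro hx
    exact ⟨⟨x, mem_endOrder_of_mem_coeIdeal_mul μ ν hν hx⟩, (h𝔓 _).2 hx, rfl⟩

include hMO in
omit [Nonempty ι] [IsFractionRing (endOrder (Algebra.leftMulMatrix μ)) K]
  [IsFractionRing (endOrder (Algebra.leftMulMatrix ν)) K] in
/-- **`𝔓` is an `𝒪_K`-ideal of `T`: `𝒪_K·𝔓 = 𝔓`** (with `T`'s copy `M′`, `↑M′ = 𝒪_K`, of the maximal order) — «`𝔓`
is a fractional `𝒪_K`-ideal inside `T`». [cite: Marseglia2024CMType, §4 Prop. 4.5 (proof), p. 10] -/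
theorem mul_coeIdeal_eq_coeIdeal {M' : FractionalIdeal (endOrder (Algebra.leftMulMatrix ν))⁰ K}
    (hMO' : (M' : Set K) = (algebraMap (𝓞 K) K).range) :
    M' * (𝔓 : FractionalIdeal (endOrder (Algebra.leftMulMatrix ν))⁰ K) = 𝔓 := by
  obtain ⟨hMP, -⟩ := mul_coeIdeal_mul_eq_of_coe_eq_range μ hMO 𝔭
  have hset := coe_coeIdeal_eq_coe_coeIdeal_mul μ ν hν h𝔓
  refine (EndOrder.mul_eq_iff_forall_mul_mem_of_coe_eq_range hMO').2 fun a n hn ↦ ?_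
  rw [← SetLike.mem_coe, hset, SetLike.mem_coe] at hn ⊢
  exact (EndOrder.mul_eq_iff_forall_mul_mem_of_coe_eq_range hMO).1 hMP a n hn

include hMO in
omit [IsFractionRing (endOrder (Algebra.leftMulMatrix ν)) K] in
/-- **(4.1) «`T/𝔓 = (S + 𝔓)/𝔓 ≃ S/(S ∩ 𝔓) = S/𝔭`»**: for a maximal `𝔭`, the inclusion `S ⊆ T` induces a ring
isomorphism `S/𝔭 ≃ T/𝔓` (surjective as `T = S + 𝔓`, kernel `S ∩ 𝔓 = 𝔭`). [cite: Marseglia2024CMType, §4 Prop. 4.5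
(proof, (4.1)), p. 10] -/
theorem nonempty_quotient_ringEquiv_quotient [h𝔭 : 𝔭.IsMaximal] :
    Nonempty ((endOrder (Algebra.leftMulMatrix μ) ⧸ 𝔭) ≃+* (endOrder (Algebra.leftMulMatrix ν) ⧸ 𝔓)) := by
  set f : endOrder (Algebra.leftMulMatrix μ) →+* endOrder (Algebra.leftMulMatrix ν) ⧸ 𝔓 :=
    (Ideal.Quotient.mk 𝔓).comp (Subring.inclusion (endOrder_le_endOrder_of_mem_iff μ ν hν)) with hf
  have hsurj : Function.Surjective f := by
    intro q
    obtain ⟨t, rfl⟩ := Ideal.Quotient.mk_surjective q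
    obtain ⟨s, hs, y, hy, ht⟩ := (hν t).1 t.2
    refine ⟨⟨s, hs⟩, ?_⟩
    rw [hf, RingHom.comp_apply, Ideal.Quotient.eq, h𝔓, AddSubgroupClass.coe_sub, Subring.coe_inclusion]
    have : ((⟨s, hs⟩ : endOrder (Algebra.leftMulMatrix μ)) : K) - (t : K) = -y := by
      rw [ht]; ring
    rw [this]
    exact Submodule.neg_mem _ hy
  have hker : RingHom.ker f = 𝔭 := by
    ext s
    rw [RingHom.mem_ker, hf, RingHom.comp_apply, Ideal.Quotient.eq_zero_iff_mem, h𝔓, Subring.coe_inclusion,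
      mem_iff_coe_mem_coeIdeal_mul μ hMO s]
  exact ⟨(Ideal.quotEquivOfEq hker.symm).trans (RingHom.quotientKerEquivOfSurjective hsurj)⟩

include hMO in
omit [IsFractionRing (endOrder (Algebra.leftMulMatrix ν)) K] in
/-- **«which, in particular, shows that `𝔓` is a prime of `T`»: `𝔓` is a maximal ideal of `T`** (`T/𝔓 ≃ S/𝔭` is a
field). [cite: Marseglia2024CMType, §4 Prop. 4.5 (proof, (4.1)), p. 10] -/
theorem isMaximal_of_mem_iff [h𝔭 : 𝔭.IsMaximal] : 𝔓.IsMaximal := by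
  obtain ⟨e⟩ := nonempty_quotient_ringEquiv_quotient μ ν hMO hν h𝔓
  letI : Field (endOrder (Algebra.leftMulMatrix μ) ⧸ 𝔭) := Ideal.Quotient.field 𝔭
  exact Ideal.Quotient.maximal_of_isField 𝔓
    (MulEquiv.isField (Field.toIsField (endOrder (Algebra.leftMulMatrix μ) ⧸ 𝔭)) e.symm.toMulEquiv)

include hMO in
omit [IsFractionRing (endOrder (Algebra.leftMulMatrix ν)) K] in
/-- **`#(T/𝔓) = #(S/𝔭)`** (4.1). [cite: Marseglia2024CMType, §4 Prop. 4.5 (proof, (4.1)), p. 10] -/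
theorem natCard_quotient_eq_natCard_quotient [h𝔭 : 𝔭.IsMaximal] :
    Nat.card (endOrder (Algebra.leftMulMatrix ν) ⧸ 𝔓) = Nat.card (endOrder (Algebra.leftMulMatrix μ) ⧸ 𝔭) := by
  obtain ⟨e⟩ := nonempty_quotient_ringEquiv_quotient μ ν hMO hν h𝔓
  exact Nat.card_congr e.symm.toEquiv

include hMO in
omit [Nonempty ι] [IsFractionRing (endOrder (Algebra.leftMulMatrix μ)) K]
  [IsFractionRing (endOrder (Algebra.leftMulMatrix ν)) K] in
/-- **(4.2) «`𝒪_K/𝔭𝒪_K = 𝒪_K/𝔓`» as abelian groups: `#(𝒪_K/𝔓𝒪_K) = #(𝒪_K/𝔭𝒪_K)`**, the left over `T` (`↥↑M′ ⧸ 𝔓 • ⊤`),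
the right over `S` (`↥↑M ⧸ 𝔭 • ⊤`) — both are `𝒪_K` modulo the same lattice `𝔓 = 𝔓𝒪_K = 𝔭𝒪_K`.
[cite: Marseglia2024CMType, §4 Prop. 4.5 (proof, (4.2)), p. 10] -/
theorem natCard_quotient_smul_top_eq {M' : FractionalIdeal (endOrder (Algebra.leftMulMatrix ν))⁰ K}
    (hMO' : (M' : Set K) = (algebraMap (𝓞 K) K).range) :
    Nat.card (↥(M' : Submodule (endOrder (Algebra.leftMulMatrix ν)) K) ⧸
        (𝔓 • ⊤ : Submodule (endOrder (Algebra.leftMulMatrix ν)) (M' : Submodule (endOrder (Algebra.leftMulMatrix ν)) K))) =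
      Nat.card (↥(M : Submodule (endOrder (Algebra.leftMulMatrix μ)) K) ⧸
        (𝔭 • ⊤ : Submodule (endOrder (Algebra.leftMulMatrix μ)) (M : Submodule (endOrder (Algebra.leftMulMatrix μ)) K))) := by
  have hI : (M' : Submodule (endOrder (Algebra.leftMulMatrix ν)) K).restrictScalars ℤ =
      (M : Submodule (endOrder (Algebra.leftMulMatrix μ)) K).restrictScalars ℤ := by
    ext x
    rw [Submodule.restrictScalars_mem, Submodule.restrictScalars_mem, mem_coe, mem_coe, ← SetLike.mem_coe, hMO',
      ← SetLike.mem_coe, hMO]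
  have hJ : ((((𝔓 : FractionalIdeal (endOrder (Algebra.leftMulMatrix ν))⁰ K) * M' :
      FractionalIdeal (endOrder (Algebra.leftMulMatrix ν))⁰ K) : Submodule (endOrder (Algebra.leftMulMatrix ν)) K)).restrictScalars ℤ =
      ((((𝔭 : FractionalIdeal (endOrder (Algebra.leftMulMatrix μ))⁰ K) * M :
        FractionalIdeal (endOrder (Algebra.leftMulMatrix μ))⁰ K) : Submodule (endOrder (Algebra.leftMulMatrix μ)) K)).restrictScalars ℤ := by
    rw [mul_comm, mul_coeIdeal_eq_coeIdeal μ ν hMO hν h𝔓 hMO']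
    ext x
    rw [Submodule.restrictScalars_mem, Submodule.restrictScalars_mem, mem_coe, mem_coe, ← SetLike.mem_coe,
      coe_coeIdeal_eq_coe_coeIdeal_mul μ ν hν h𝔓, SetLike.mem_coe]
  rw [← natCard_quotient_comap_coeIdeal_mul ν 𝔓 M', ← natCard_quotient_comap_coeIdeal_mul μ 𝔭 M,
    ← natCard_quotient_comap_restrictScalars ν, ← natCard_quotient_comap_restrictScalars μ]
  exact natCard_quotient_comap_congr hI hJ

include hMO in
omit [IsFractionRing (endOrder (Algebra.leftMulMatrix ν)) K] in
/-- **(4.1) + (4.2): `dim_{T/𝔓} 𝒪_K/𝔓 = dim_{S/𝔭} 𝒪_K/𝔭𝒪_K`** («the last equality is given by Equations (4.1) and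
(4.2)»): same finite abelian group, residue fields of the same size. [cite: Marseglia2024CMType, §4 Prop. 4.5
(proof), p. 10] -/
theorem finrank_quotient_smul_top_eq [h𝔭 : 𝔭.IsMaximal] {M' : FractionalIdeal (endOrder (Algebra.leftMulMatrix ν))⁰ K}
    (hMO' : (M' : Set K) = (algebraMap (𝓞 K) K).range) :
    Module.finrank (endOrder (Algebra.leftMulMatrix ν) ⧸ 𝔓)
        (↥(M' : Submodule (endOrder (Algebra.leftMulMatrix ν)) K) ⧸
          (𝔓 • ⊤ : Submodule (endOrder (Algebra.leftMulMatrix ν))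
            (M' : Submodule (endOrder (Algebra.leftMulMatrix ν)) K))) =
      Module.finrank (endOrder (Algebra.leftMulMatrix μ) ⧸ 𝔭)
        (↥(M : Submodule (endOrder (Algebra.leftMulMatrix μ)) K) ⧸
          (𝔭 • ⊤ : Submodule (endOrder (Algebra.leftMulMatrix μ))
            (M : Submodule (endOrder (Algebra.leftMulMatrix μ)) K))) := by
  haveI := isMaximal_of_mem_iff μ ν hMO hν h𝔓
  haveI := isNoetherianRing_endOrder (Algebra.leftMulMatrix μ)
  haveI := isNoetherianRing_endOrder (Algebra.leftMulMatrix ν)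
  letI : Field (endOrder (Algebra.leftMulMatrix μ) ⧸ 𝔭) := Ideal.Quotient.field 𝔭
  letI : Field (endOrder (Algebra.leftMulMatrix ν) ⧸ 𝔓) := Ideal.Quotient.field 𝔓
  haveI := NumberRing.finite_quotient_smul_top (K := K) 𝔭
    (fg_of_isNoetherianRing le_rfl M : ((M : FractionalIdeal (endOrder (Algebra.leftMulMatrix μ))⁰ K) :
      Submodule (endOrder (Algebra.leftMulMatrix μ)) K).FG)
  haveI := NumberRing.finite_quotient_smul_top (K := K) 𝔓
    (fg_of_isNoetherianRing le_rfl M' : ((M' : FractionalIdeal (endOrder (Algebra.leftMulMatrix ν))⁰ K) :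
      Submodule (endOrder (Algebra.leftMulMatrix ν)) K).FG)
  have h := natCard_quotient_smul_top_eq μ ν hMO hν h𝔓 hMO'
  rw [Module.natCard_eq_pow_finrank (K := endOrder (Algebra.leftMulMatrix ν) ⧸ 𝔓)
      (V := ↥(M' : Submodule (endOrder (Algebra.leftMulMatrix ν)) K) ⧸
        (𝔓 • ⊤ : Submodule (endOrder (Algebra.leftMulMatrix ν)) (M' : Submodule (endOrder (Algebra.leftMulMatrix ν)) K))),
    Module.natCard_eq_pow_finrank (K := endOrder (Algebra.leftMulMatrix μ) ⧸ 𝔭)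
      (V := ↥(M : Submodule (endOrder (Algebra.leftMulMatrix μ)) K) ⧸
        (𝔭 • ⊤ : Submodule (endOrder (Algebra.leftMulMatrix μ)) (M : Submodule (endOrder (Algebra.leftMulMatrix μ)) K))),
    natCard_quotient_eq_natCard_quotient μ ν hMO hν h𝔓] at h
  have h0 : 𝔭 ≠ ⊥ := Ring.ne_bot_of_isMaximal_of_not_isField h𝔭 EndOrder.not_isField
  exact Nat.pow_right_injective (one_lt_natCard_quotient μ h0 h𝔭.ne_top) h

include hMO in
/-- **«Hence `𝔓` is not invertible», i.e. `T ≠ 𝒪_K`, when `𝔭` is not invertible** (if `T = 𝒪_K` then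
`dim_{T/𝔓} 𝒪_K/𝔓 = 1`, so `dim_{S/𝔭} 𝒪_K/𝔭𝒪_K = 1` and `𝔭` would be invertible by LEMMA 2.14 (i)).
[cite: Marseglia2024CMType, §4 Prop. 4.5 (proof: «If `𝔓` were invertible then […] we would have `(𝔓:𝔓) = T` […]
Hence `𝔓` is not invertible»), p. 10] -/
theorem exists_coe_not_mem_endOrder_of_not_isUnit [h𝔭 : 𝔭.IsMaximal]
    (hu : ¬ IsUnit (𝔭 : FractionalIdeal (endOrder (Algebra.leftMulMatrix μ))⁰ K)) :
    ∃ a : 𝓞 K, (a : K) ∉ endOrder (Algebra.leftMulMatrix ν) := by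
  by_contra hall
  push Not at hall
  haveI := isMaximal_of_mem_iff μ ν hMO hν h𝔓
  obtain ⟨M', -, -, hMO'⟩ := EndOrder.exists_idempotent_coe_eq_range (ρ := Algebra.leftMulMatrix ν) (K := K)
  have h1 := (finrank_quotient_eq_one_iff_forall_coe_mem_of_mul_coeIdeal_eq ν hMO'
    (mul_coeIdeal_eq_coeIdeal μ ν hMO hν h𝔓 hMO')).2 hall
  rw [finrank_quotient_smul_top_eq μ ν hMO hν h𝔓 hMO'] at h1
  have h0 : 𝔭 ≠ ⊥ := Ring.ne_bot_of_isMaximal_of_not_isField h𝔭 EndOrder.not_isField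
  exact hu ((EndOrder.finrank_quotient_eq_one_iff_isUnit_coeIdeal hMO h0).1 h1)

/-! ## §3 PROPOSITION 4.5: `dim_{S/𝔭} 𝒪_K/𝔭𝒪_K = 1 + type(S + 𝔭𝒪_K)` -/

include hMO in
/-- **MARSEGLIA 2024 PROPOSITION 4.5 (the non-invertible case, at the prime `𝔓`):
`dim_{S/𝔭} 𝒪_K/𝔭𝒪_K = 1 + type_𝔓(S + 𝔭𝒪_K)`** for a maximal non-invertible `𝔭` of `S = endOrder (M_μ)`, the
over-order `T = S + 𝔭𝒪_K = endOrder (M_ν)`, its prime `𝔓 = 𝔭𝒪_K` and its trace dual `Tᵗ` (`↑T′ = (Tᵗ)`).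
[cite: Marseglia2024CMType, §4 Prop. 4.5, p. 10] -/
theorem finrank_quotient_smul_top_eq_finrank_traceDual_quotient_add_one [h𝔭 : 𝔭.IsMaximal]
    (hu : ¬ IsUnit (𝔭 : FractionalIdeal (endOrder (Algebra.leftMulMatrix μ))⁰ K))
    {T' : FractionalIdeal (endOrder (Algebra.leftMulMatrix ν))⁰ K}
    (hT' : (T' : Submodule (endOrder (Algebra.leftMulMatrix ν)) K) =
      traceDual ℤ ℚ ((1 : FractionalIdeal (endOrder (Algebra.leftMulMatrix ν))⁰ K) :
        Submodule (endOrder (Algebra.leftMulMatrix ν)) K)) :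
    Module.finrank (endOrder (Algebra.leftMulMatrix μ) ⧸ 𝔭)
        (↥(M : Submodule (endOrder (Algebra.leftMulMatrix μ)) K) ⧸
          (𝔭 • ⊤ : Submodule (endOrder (Algebra.leftMulMatrix μ))
            (M : Submodule (endOrder (Algebra.leftMulMatrix μ)) K))) =
      Module.finrank (endOrder (Algebra.leftMulMatrix ν) ⧸ 𝔓)
        ((T' : Submodule (endOrder (Algebra.leftMulMatrix ν)) K) ⧸
          (𝔓 • ⊤ : Submodule (endOrder (Algebra.leftMulMatrix ν))
            (T' : Submodule (endOrder (Algebra.leftMulMatrix ν)) K))) + 1 := by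
  haveI := isMaximal_of_mem_iff μ ν hMO hν h𝔓
  obtain ⟨M', -, -, hMO'⟩ := EndOrder.exists_idempotent_coe_eq_range (ρ := Algebra.leftMulMatrix ν) (K := K)
  rw [← finrank_quotient_smul_top_eq μ ν hMO hν h𝔓 hMO']
  exact (finrank_traceDual_quotient_add_one_eq_finrank_quotient_of_mul_coeIdeal_eq ν hMO'
    (mul_coeIdeal_eq_coeIdeal μ ν hMO hν h𝔓 hMO') (exists_coe_not_mem_endOrder_of_not_isUnit μ ν hMO hν h𝔓 hu)
    hT').symm

include hMO in
/-- **MARSEGLIA 2024 PROPOSITION 4.5: `dim_{S/𝔭} 𝒪_K/𝔭𝒪_K = 1 + type(S + 𝔭𝒪_K)`** for a maximal non-invertible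
prime `𝔭` of `S` — with the global type `type(T) = max_𝔔 type_𝔔(T) = ⨆ 𝔔, type_𝔔(T)` of `T = S + 𝔭𝒪_K`, which is
`type_𝔓(T)` («the only contribution to the global type of `T` comes from `𝔓`»).  The invertible case
«`dim_{S/𝔭} 𝒪_K/𝔭𝒪_K = 1` iff `𝔭` is invertible» is `EndOrder.finrank_quotient_eq_one_iff_isUnit_coeIdeal`
(`CMOrderCohenMacaulayTypeOne`, LEMMA 2.14 (i)). [cite: Marseglia2024CMType, §4 Prop. 4.5, p. 10] -/
theorem finrank_quotient_smul_top_eq_iSup_finrank_traceDual_quotient_add_one [h𝔭 : 𝔭.IsMaximal]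
    (hu : ¬ IsUnit (𝔭 : FractionalIdeal (endOrder (Algebra.leftMulMatrix μ))⁰ K))
    {T' : FractionalIdeal (endOrder (Algebra.leftMulMatrix ν))⁰ K}
    (hT' : (T' : Submodule (endOrder (Algebra.leftMulMatrix ν)) K) =
      traceDual ℤ ℚ ((1 : FractionalIdeal (endOrder (Algebra.leftMulMatrix ν))⁰ K) :
        Submodule (endOrder (Algebra.leftMulMatrix ν)) K)) :
    Module.finrank (endOrder (Algebra.leftMulMatrix μ) ⧸ 𝔭)
        (↥(M : Submodule (endOrder (Algebra.leftMulMatrix μ)) K) ⧸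
          (𝔭 • ⊤ : Submodule (endOrder (Algebra.leftMulMatrix μ))
            (M : Submodule (endOrder (Algebra.leftMulMatrix μ)) K))) =
      (⨆ 𝔔 : MaximalSpectrum (endOrder (Algebra.leftMulMatrix ν)),
        Module.finrank (endOrder (Algebra.leftMulMatrix ν) ⧸ 𝔔.asIdeal)
          ((T' : Submodule (endOrder (Algebra.leftMulMatrix ν)) K) ⧸
            (𝔔.asIdeal • ⊤ : Submodule (endOrder (Algebra.leftMulMatrix ν))
              (T' : Submodule (endOrder (Algebra.leftMulMatrix ν)) K)))) + 1 := by
  haveI := isMaximal_of_mem_iff μ ν hMO hν h𝔓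
  obtain ⟨M', -, -, hMO'⟩ := EndOrder.exists_idempotent_coe_eq_range (ρ := Algebra.leftMulMatrix ν) (K := K)
  rw [iSup_finrank_traceDual_quotient_eq_of_mul_coeIdeal_eq ν hMO' (mul_coeIdeal_eq_coeIdeal μ ν hMO hν h𝔓 hMO')
    (exists_coe_not_mem_endOrder_of_not_isUnit μ ν hMO hν h𝔓 hu) hT']
  exact finrank_quotient_smul_top_eq_finrank_traceDual_quotient_add_one μ ν hMO hν h𝔓 hu hT'

end PlusPrime

/-! ## §4 PROPOSITION 4.5, basis-free packaging -/

/-- **MARSEGLIA 2024 PROPOSITION 4.5 for the order `S = endOrder (M_μ)` and a maximal non-invertible prime `𝔭`: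
there is an over-order `T = S + 𝔭𝒪_K` (an `endOrder (M_ν)`, with `T = {s + y : s ∈ S, y ∈ 𝔭𝒪_K}`) such that
`dim_{S/𝔭} 𝒪_K/𝔭𝒪_K = 1 + type(T)`.** [cite: Marseglia2024CMType, §4 Prop. 4.5, p. 10] -/
theorem exists_basis_finrank_quotient_smul_top_eq_iSup_add_one {M : FractionalIdeal (endOrder (Algebra.leftMulMatrix μ))⁰ K}
    (hMO : (M : Set K) = (algebraMap (𝓞 K) K).range) {𝔭 : Ideal (endOrder (Algebra.leftMulMatrix μ))}
    [h𝔭 : 𝔭.IsMaximal] (hu : ¬ IsUnit (𝔭 : FractionalIdeal (endOrder (Algebra.leftMulMatrix μ))⁰ K)) :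
    ∃ ν : Basis ι ℚ K,
      (∀ x : K, x ∈ endOrder (Algebra.leftMulMatrix ν) ↔
        ∃ s ∈ endOrder (Algebra.leftMulMatrix μ),
          ∃ y ∈ (𝔭 : FractionalIdeal (endOrder (Algebra.leftMulMatrix μ))⁰ K) * M, x = s + y) ∧
      endOrder (Algebra.leftMulMatrix μ) ≤ endOrder (Algebra.leftMulMatrix ν) ∧
      ∀ T' : FractionalIdeal (endOrder (Algebra.leftMulMatrix ν))⁰ K,
        (T' : Submodule (endOrder (Algebra.leftMulMatrix ν)) K) =
          traceDual ℤ ℚ ((1 : FractionalIdeal (endOrder (Algebra.leftMulMatrix ν))⁰ K) :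
            Submodule (endOrder (Algebra.leftMulMatrix ν)) K) →
        Module.finrank (endOrder (Algebra.leftMulMatrix μ) ⧸ 𝔭)
            (↥(M : Submodule (endOrder (Algebra.leftMulMatrix μ)) K) ⧸
              (𝔭 • ⊤ : Submodule (endOrder (Algebra.leftMulMatrix μ))
                (M : Submodule (endOrder (Algebra.leftMulMatrix μ)) K))) =
          (⨆ 𝔔 : MaximalSpectrum (endOrder (Algebra.leftMulMatrix ν)),
            Module.finrank (endOrder (Algebra.leftMulMatrix ν) ⧸ 𝔔.asIdeal)
              ((T' : Submodule (endOrder (Algebra.leftMulMatrix ν)) K) ⧸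
                (𝔔.asIdeal • ⊤ : Submodule (endOrder (Algebra.leftMulMatrix ν))
                  (T' : Submodule (endOrder (Algebra.leftMulMatrix ν)) K)))) + 1 := by
  obtain ⟨ν, hν⟩ := exists_basis_mem_endOrder_iff_exists_add μ hMO 𝔭
  haveI := isFractionRing_endOrder (Algebra.leftMulMatrix ν)
  obtain ⟨𝔓, h𝔓⟩ := exists_ideal_mem_iff_coe_mem μ ν hMO hν
  exact ⟨ν, hν, endOrder_le_endOrder_of_mem_iff μ ν hν, fun T' hT' ↦
    finrank_quotient_smul_top_eq_iSup_finrank_traceDual_quotient_add_one μ ν hMO hν h𝔓 hu hT'⟩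

end CMTypeLattice

end Literature.NumberTheory.ComplexMultiplication
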